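import Literature.Analysis.FluidPDE.PassiveScalarEnergySlice
import Literature.Analysis.FunctionSpaces.TorusMollifiedGradNorm
import HarnessLib

/-!
# Energy identity for BOUNDED passive scalars along `L²` drifts, I: slice estimates

Analysis/FluidPDE proof-support file (everything proved; no definitions, no named facts), first of
the files discharging the named fact `MescoliniPitchoSorella2025_thm24`
(`VanishingDiffusivitySelectionBV.lean`; Mescolini–Pitcho–Sorella, Ann. Mat. Pura Appl. 204 (2025),
Thm. 2.4: bounded weak solutions of `∂ₜρ + b·∇ρ = νΔρ` along a divergence-free drift
`b ∈ L²((0,T) × T^d)` with `ρ_in ∈ L^∞`). It is the counterpart of `PassiveScalarEnergySlice` (the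
slice computation of the mollified energy balance for an a.e.-BOUNDED drift and an `L¹` slice,
Bonicatto–Ciampa–Crippa 2024, Thm. 3.3 in the corner `p = ∞`, `q = 2`) in the OTHER corner of
Bonicatto–Ciampa–Crippa's Thm. 3.3, `p = 2`, `q = ∞`: the slice `δ = θ(s)` is a.e. BOUNDED and the
drift slice `v = b(s)` is merely INTEGRABLE.

For a slice `δ`, a drift slice `v`, the torus kernel `k = kernel ε`, `A = δ ⋆ k`, `B = A ⋆ k` and the
flux `G(x) = ∫ δ(y) (-⟪v y, ∇k(x-y)⟫ + κ Δk(x-y)) dy` (the right-hand side of `∂ₜ(θ ⋆ k)`):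

* the slice computations of `PassiveScalarEnergySlice` — `∫ A (∫ δ ⟪v, ∇k(x-·)⟫) = -∫ δ ⟪v, ∇B⟫`,
  `∫ A G = ∫ δ ⟪v, ∇B⟫ - κ ∫ ‖∇A‖²`, `∫ δ ⟪v, ∇B⟫ = ∫ (δ - B) ⟪v, ∇B⟫` — under the PRODUCT
  hypothesis `‖v‖ δ ∈ L¹` (and `v ∈ L¹` for the last one) instead of an a.e. bound on `v`
  (`…_of_integrable`; the proofs are those of `PassiveScalarEnergySlice`, only the dominations change);
* `|(δ ⋆ k)(x)| ≤ M` for an a.e. bound `|δ| ≤ M` and a nonnegative unit-mass kernel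
  (`abs_convolution_le_of_ae_abs_le`; the tree's `abs_convolution_le_of_forall_abs_le` wants the
  bound everywhere);
* Cauchy–Schwarz in `ℝ≥0∞` with the extended norm on the left (`enorm_integral_mul_le_eLpNorm_mul`);
* **the slice energy estimate for bounded slices and integrable drifts**
  (`enorm_integral_conv_mul_flux_add_le`):
  `‖∫ A G + κ ∫ ‖∇A‖²‖ₑ ≤ ‖(δ - B) ‖v‖‖_{L²} · ‖∇A‖_{L²}`,
  i.e. the remainder of the mollified energy balance is controlled by the weighted `L²` norm
  `R = ‖(δ - B)·‖v‖‖_{L²}` (which tends to `0` along `ε → 0` when `|δ| ≤ M` and `v ∈ L²`, by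
  dominated convergence — used in the sequel `PassiveScalarBoundedEnergyEquality`), TWO-SIDED so
  that it serves the energy EQUALITY and not only the inequality;
* **mollification does not increase the spectral gradient norm of a scalar**,
  `eScalarGradNormSq (f ⋆ kernel ε) ≤ eScalarGradNormSq f` (`eScalarGradNormSq_convolution_kernel_le`,
  the scalar twin of `Torus.eGradNormSq_vecMollify_le`: `|k̂_ε| ≤ 1` termwise), and the Fourier
  coefficients of the mollified scalar (`mFourierCoeff_ofReal_convolution_kernel'`).

## Mathlib / tree search

Tree (reused by name): `continuous_fluxIntegral`, `integral_mul_inner_gradient_eq_zero`,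
`gradient_kernel_sub_comm`, `eLpNorm_norm_gradient_conv_kernel_le`, `integral_mul_laplacian_eq_neg_sum`
(`PassiveScalarProofs` / `PassiveScalarEnergySlice`), `mFourierCoeff_ofReal_convolution_kernel`,
`norm_mFourierCoeff_ofReal_le_one` (`TorusMollifiedGradNorm`), `eScalarGradNormSq_eq_tsum`.
`lean search 'conv_mul_flux|abs_convolution_le'`: only the bounded-drift / everywhere-bounded forms.
Mathlib: `integral_sub_left_eq_self`, `norm_integral_le_of_norm_le`, `ENNReal.lintegral_mul_le_Lp_mul_Lq`.

## References

* G. Mescolini, J. Pitcho, M. Sorella, Ann. Mat. Pura Appl. (4) 204 (2025) 1667–1687, Thm. 2.4 and its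
  proof pp. 1671–1674 (mollification, energy estimate, commutator). [`MescoliniPitchoSorella2025`]
* P. Bonicatto, G. Ciampa, G. Crippa, J. Evol. Equ. 24 (2024), Paper No. 1, Lemma 3.1, Thm. 3.3.
  [`BonicattoCiampaCrippa2023`]
-/

noncomputable section

open MeasureTheory TopologicalSpace Set Function Filter Metric ContinuousLinearMap UnitAddTorus
open _root_.Topology
open scoped ENNReal NNReal Convolution ContDiff InnerProductSpace

namespace Literature.Analysis.FluidPDE

namespace Torus

variable {d : Type*} [Fintype d]

/-! ## Two elementary tools -/

section Tools

/-- **Mollification by a nonnegative unit-mass kernel preserves a.e. sup bounds**: if `|δ| ≤ M`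
a.e. then `|(δ ⋆ k)(x)| ≤ M` for EVERY `x` (`(δ ⋆ k)(x) = ∫ δ(y) k(x - y) dy`, `k ≥ 0`, `∫ k = 1`,
translation invariance of the Haar measure; Young's inequality at `p = ∞`). [cite: Grafakos2014, Thm. 1.2.10 (p = ∞)] -/
theorem abs_convolution_le_of_ae_abs_le {δ : UnitAddTorus d → ℝ} {M : ℝ}
    (hδb : ∀ᵐ y ∂(volume : Measure (UnitAddTorus d)), |δ y| ≤ M) {k : UnitAddTorus d → ℝ}
    (hk0 : ∀ y, 0 ≤ k y) (hk1 : ∫ y, k y = 1) (hkc : Continuous k) (x : UnitAddTorus d) :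
    |(δ ⋆ k) x| ≤ M := by
  have hconv : (δ ⋆ k) x = ∫ y, δ y * k (x - y) := by simp only [convolution_lsmul, smul_eq_mul]
  rw [hconv, ← Real.norm_eq_abs]
  have hgi : Integrable (fun y => M * k (x - y)) (volume : Measure (UnitAddTorus d)) :=
    ((continuous_const.mul (hkc.comp (continuous_const.sub continuous_id))).integrable_unitAddTorus)
  refine (norm_integral_le_of_norm_le hgi ?_).trans ?_
  · filter_upwards [hδb] with y hy
    rw [norm_mul, Real.norm_eq_abs, Real.norm_eq_abs, abs_of_nonneg (hk0 _)]
    exact mul_le_mul_of_nonneg_right hy (hk0 _)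
  · rw [MeasureTheory.integral_const_mul, integral_sub_left_eq_self (fun z => k z) volume x, hk1, mul_one]

/-- **Cauchy–Schwarz in `ℝ≥0∞` form with the extended norm**: `‖∫ A r‖ₑ ≤ ‖A‖_{L²} ‖r‖_{L²}`
(two-sided twin of `ofReal_integral_mul_le_eLpNorm_mul`; Hölder's inequality). [cite: Brezis2011, Thm. 4.6 (Hölder)] -/
theorem enorm_integral_mul_le_eLpNorm_mul {A r : UnitAddTorus d → ℝ} (hA : AEStronglyMeasurable A volume)
    (hr : AEStronglyMeasurable r volume) :
    ‖∫ x, A x * r x‖ₑ ≤ eLpNorm A 2 volume * eLpNorm r 2 volume := by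
  refine (enorm_integral_le_lintegral_enorm _).trans ?_
  simp_rw [enorm_mul]
  have h := ENNReal.lintegral_mul_le_Lp_mul_Lq (volume : Measure (UnitAddTorus d))
    Real.HolderConjugate.two_two hA.enorm hr.enorm
  rw [eLpNorm_eq_lintegral_rpow_enorm_toReal two_ne_zero ENNReal.ofNat_ne_top,
    eLpNorm_eq_lintegral_rpow_enorm_toReal two_ne_zero ENNReal.ofNat_ne_top, ENNReal.toReal_ofNat]
  exact h

/-- `‖v‖ δ ∈ L¹` for an a.e.-bounded measurable `δ` and an integrable `v` (Hölder, `p = 1`, `q = ∞`). [cite: Brezis2011, Thm. 4.6 (Hölder)] -/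
theorem integrable_norm_mul_of_ae_abs_le {δ : UnitAddTorus d → ℝ} {v : UnitAddTorus d → EuclideanSpace ℝ d}
    (hδm : AEStronglyMeasurable δ volume) {M : ℝ} (hδb : ∀ᵐ y ∂(volume : Measure (UnitAddTorus d)), |δ y| ≤ M)
    (hv : Integrable v volume) : Integrable (fun y => ‖v y‖ * δ y) volume :=
  hv.norm.mul_bdd hδm (hδb.mono fun y hy => by rw [Real.norm_eq_abs]; exact hy)

end Tools

/-! ## The slice computations under product integrability -/

section Slice

variable {δ : UnitAddTorus d → ℝ} {v : UnitAddTorus d → EuclideanSpace ℝ d} {ε : ℝ}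

/-- **The transport pairing of a slice, swapped onto the double mollification**, for `δ ∈ L¹`,
a measurable drift slice `v` with `‖v‖ δ ∈ L¹`, and the torus kernel `k = kernel ε`:
`∫ A(x) (∫ δ(y) ⟪v(y), ∇k(x - y)⟫ dy) dx = -∫ δ(y) ⟪v(y), ∇B(y)⟫ dy`, `A = δ ⋆ k`, `B = A ⋆ k`
(Fubini; `∇k` is odd). Generalises `integral_conv_mul_transport_eq` (a.e.-bounded `v`). [cite: BonicattoCiampaCrippa2023, Thm. 3.3 proof (3.1)] -/
theorem integral_conv_mul_transport_eq_of_integrable (hδ : Integrable δ volume)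
    (hv : AEStronglyMeasurable v volume) (hvδ : Integrable (fun y => ‖v y‖ * δ y) volume)
    (hε : 0 < ε) (hε' : ε ≤ 1 / 4) :
    ∫ x, (δ ⋆ FunctionSpaces.Torus.kernel ε) x * ∫ y, δ y * ⟪v y, FunctionSpaces.Torus.gradient (FunctionSpaces.Torus.kernel ε) (x - y)⟫_ℝ =
      -∫ y, δ y * ⟪v y, FunctionSpaces.Torus.gradient ((δ ⋆ FunctionSpaces.Torus.kernel ε) ⋆ FunctionSpaces.Torus.kernel ε) y⟫_ℝ := by
  set k : UnitAddTorus d → ℝ := FunctionSpaces.Torus.kernel ε with hk_def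
  have hk : FunctionSpaces.Torus.IsSmooth k := FunctionSpaces.Torus.isSmooth_kernel hε hε'
  set A : UnitAddTorus d → ℝ := δ ⋆ k with hA_def
  have hA : FunctionSpaces.Torus.IsSmooth A := FunctionSpaces.Torus.isSmooth_convolution hδ hk
  have hAi : Integrable A volume := hA.integrable
  obtain ⟨CA, hCA⟩ := FunctionSpaces.Torus.exists_forall_norm_le_of_continuous hA.continuous
  obtain ⟨Ck, hCk⟩ := FunctionSpaces.Torus.exists_forall_norm_le_of_continuous hk.gradient.continuous
  -- the integrand on `T^d × T^d` and its integrability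
  set F : UnitAddTorus d → UnitAddTorus d → ℝ := fun x y =>
    A x * (δ y * ⟪v y, FunctionSpaces.Torus.gradient k (x - y)⟫_ℝ) with hF_def
  have hgc : Continuous fun p : UnitAddTorus d × UnitAddTorus d => FunctionSpaces.Torus.gradient k (p.1 - p.2) :=
    hk.gradient.continuous.comp (continuous_fst.sub continuous_snd)
  have hFm : AEStronglyMeasurable (uncurry F) ((volume : Measure (UnitAddTorus d)).prod volume) := by
    refine ((hA.continuous.comp continuous_fst).aestronglyMeasurable).mul
      ((hδ.aestronglyMeasurable.comp_snd).mul ((hv.comp_snd).inner hgc.aestronglyMeasurable))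
  have hFi : Integrable (uncurry F) ((volume : Measure (UnitAddTorus d)).prod volume) := by
    refine Integrable.mono' (g := fun p : UnitAddTorus d × UnitAddTorus d => CA * Ck * ‖‖v p.2‖ * δ p.2‖)
      (((integrable_const (CA * Ck)).mul_prod hvδ.norm)) hFm ?_
    refine Eventually.of_forall fun p => ?_
    simp only [uncurry, hF_def, norm_mul, Real.norm_eq_abs, abs_norm]
    have h1 : |⟪v p.2, FunctionSpaces.Torus.gradient k (p.1 - p.2)⟫_ℝ| ≤ ‖v p.2‖ * Ck :=
      (abs_real_inner_le_norm _ _).trans (mul_le_mul_of_nonneg_left (hCk _) (norm_nonneg _))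
    have h2 : |A p.1| ≤ CA := by simpa [Real.norm_eq_abs] using hCA p.1
    have hCA0 : 0 ≤ CA := (abs_nonneg _).trans h2
    calc |A p.1| * (|δ p.2| * |⟪v p.2, FunctionSpaces.Torus.gradient k (p.1 - p.2)⟫_ℝ|)
        ≤ CA * (|δ p.2| * (‖v p.2‖ * Ck)) := by gcongr
      _ = CA * Ck * (‖v p.2‖ * |δ p.2|) := by ring
  -- swap the integrals
  have hswap := integral_integral_swap hFi
  have hlhs : ∫ x, A x * ∫ y, δ y * ⟪v y, FunctionSpaces.Torus.gradient k (x - y)⟫_ℝ = ∫ x, ∫ y, F x y := by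
    refine integral_congr_ae (Eventually.of_forall fun x => ?_)
    simp only [hF_def]
    exact (MeasureTheory.integral_const_mul _ _).symm
  rw [hlhs, hswap]
  -- the inner `x`-integral: `∫ A(x) ∇k(x - y) dx = -∇B(y)`
  have hinner : ∀ y, ∫ x, F x y = -(δ y * ⟪v y, FunctionSpaces.Torus.gradient (A ⋆ k) y⟫_ℝ) := by
    intro y
    have hint : Integrable (fun x => A x • FunctionSpaces.Torus.gradient k (y - x)) volume :=
      FunctionSpaces.Torus.integrable_smul_comp_sub hAi hk.gradient.continuous y
    have e1 : ∀ x, F x y = -(δ y * ⟪v y, A x • FunctionSpaces.Torus.gradient k (y - x)⟫_ℝ) := fun x => by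
      simp only [hF_def]
      rw [gradient_kernel_sub_comm hε hε' x y, inner_neg_right, real_inner_smul_right]
      ring
    simp_rw [e1]
    rw [integral_neg, MeasureTheory.integral_const_mul, integral_inner hint,
      FunctionSpaces.Torus.gradient_convolution hAi hk y, convolution_lsmul]
  simp_rw [hinner]
  rw [integral_neg]

/-- **The flux pairing of a slice** under product integrability: with
`G(x) = ∫ δ(y) (-⟪v y, ∇k(x-y)⟫ + κ Δk(x-y)) dy`, `A = δ ⋆ k`, `B = A ⋆ k`,
`∫ A G = ∫ δ ⟪v, ∇B⟫ - κ ∫ ‖∇A‖²`. Generalises `integral_conv_mul_flux_eq`. [cite: BonicattoCiampaCrippa2023, Thm. 3.3 proof (3.1)] -/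
theorem integral_conv_mul_flux_eq_of_integrable (hδ : Integrable δ volume)
    (hv : AEStronglyMeasurable v volume) (hvδ : Integrable (fun y => ‖v y‖ * δ y) volume)
    (hε : 0 < ε) (hε' : ε ≤ 1 / 4) (κ : ℝ) :
    ∫ x, (δ ⋆ FunctionSpaces.Torus.kernel ε) x * ∫ y, δ y *
        (-⟪v y, FunctionSpaces.Torus.gradient (FunctionSpaces.Torus.kernel ε) (x - y)⟫_ℝ + κ * FunctionSpaces.Torus.laplacian (FunctionSpaces.Torus.kernel ε) (x - y)) =
      (∫ y, δ y * ⟪v y, FunctionSpaces.Torus.gradient ((δ ⋆ FunctionSpaces.Torus.kernel ε) ⋆ FunctionSpaces.Torus.kernel ε) y⟫_ℝ) -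
        κ * ∫ x, ‖FunctionSpaces.Torus.gradient (δ ⋆ FunctionSpaces.Torus.kernel ε) x‖ ^ 2 := by
  classical
  set k : UnitAddTorus d → ℝ := FunctionSpaces.Torus.kernel ε with hk_def
  have hk : FunctionSpaces.Torus.IsSmooth k := FunctionSpaces.Torus.isSmooth_kernel hε hε'
  set A : UnitAddTorus d → ℝ := δ ⋆ k with hA_def
  have hA : FunctionSpaces.Torus.IsSmooth A := FunctionSpaces.Torus.isSmooth_convolution hδ hk
  have hA1 : FunctionSpaces.Torus.IsContDiff 1 A := hA.isContDiff (by simp)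
  -- the flux and its transport part are continuous in `x`
  have hIc : Continuous fun x => ∫ y, δ y * ⟪v y, FunctionSpaces.Torus.gradient k (x - y)⟫_ℝ := by
    have h0 := continuous_fluxIntegral hδ hv hvδ hk 0
    have e : (fun x => ∫ y, δ y * ⟪v y, FunctionSpaces.Torus.gradient k (x - y)⟫_ℝ) =
        fun x => -∫ y, δ y * (-⟪v y, FunctionSpaces.Torus.gradient k (x - y)⟫_ℝ + 0 * FunctionSpaces.Torus.laplacian k (x - y)) := by
      funext x
      rw [← integral_neg]
      refine integral_congr_ae (Eventually.of_forall fun y => ?_)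
      ring
    rw [e]
    exact h0.neg
  -- pointwise splitting of the flux: `G = -I + κ ΔA`
  obtain ⟨Ck, hCk⟩ := FunctionSpaces.Torus.exists_forall_norm_le_of_continuous hk.gradient.continuous
  obtain ⟨Cl, hCl⟩ := FunctionSpaces.Torus.exists_forall_norm_le_of_continuous hk.laplacian.continuous
  have hsplit : ∀ x, ∫ y, δ y * (-⟪v y, FunctionSpaces.Torus.gradient k (x - y)⟫_ℝ + κ * FunctionSpaces.Torus.laplacian k (x - y)) =
      -(∫ y, δ y * ⟪v y, FunctionSpaces.Torus.gradient k (x - y)⟫_ℝ) + κ * FunctionSpaces.Torus.laplacian A x := by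
    intro x
    have i1 : Integrable (fun y => δ y * ⟪v y, FunctionSpaces.Torus.gradient k (x - y)⟫_ℝ) volume := by
      refine Integrable.mono' (hvδ.norm.const_mul Ck)
        (hδ.aestronglyMeasurable.mul
          (hv.inner (hk.gradient.continuous.comp (continuous_const.sub continuous_id)).aestronglyMeasurable)) ?_
      refine Eventually.of_forall fun y => ?_
      rw [norm_mul, Real.norm_eq_abs, Real.norm_eq_abs, norm_mul, norm_norm, Real.norm_eq_abs]
      calc |δ y| * |⟪v y, FunctionSpaces.Torus.gradient k (x - y)⟫_ℝ| ≤ |δ y| * (‖v y‖ * Ck) := by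
            gcongr
            exact (abs_real_inner_le_norm _ _).trans (mul_le_mul_of_nonneg_left (hCk _) (norm_nonneg _))
        _ = Ck * (‖v y‖ * |δ y|) := by ring
    have i2 : Integrable (fun y => δ y * FunctionSpaces.Torus.laplacian k (x - y)) volume :=
      hδ.mul_bdd (c := Cl) (hk.laplacian.continuous.comp (continuous_const.sub continuous_id)).aestronglyMeasurable
        (Eventually.of_forall fun y => hCl _)
    have hlap : FunctionSpaces.Torus.laplacian A x = ∫ y, δ y * FunctionSpaces.Torus.laplacian k (x - y) := by
      rw [hA_def, FunctionSpaces.Torus.laplacian_convolution hδ hk, convolution_lsmul]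
      rfl
    rw [hlap, ← integral_neg, ← MeasureTheory.integral_const_mul, ← integral_add i1.fun_neg (i2.const_mul κ)]
    refine integral_congr_ae (Eventually.of_forall fun y => ?_)
    ring
  simp_rw [hsplit]
  have j1 : Integrable (fun x => A x * ∫ y, δ y * ⟪v y, FunctionSpaces.Torus.gradient k (x - y)⟫_ℝ) volume :=
    (hA.continuous.mul hIc).integrable_unitAddTorus
  have j2 : Integrable (fun x => κ * (A x * FunctionSpaces.Torus.laplacian A x)) volume :=
    (continuous_const.mul (hA.continuous.mul hA.laplacian.continuous)).integrable_unitAddTorus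
  have e : ∫ x, A x * (-(∫ y, δ y * ⟪v y, FunctionSpaces.Torus.gradient k (x - y)⟫_ℝ) + κ * FunctionSpaces.Torus.laplacian A x) =
      -(∫ x, A x * ∫ y, δ y * ⟪v y, FunctionSpaces.Torus.gradient k (x - y)⟫_ℝ) + κ * ∫ x, A x * FunctionSpaces.Torus.laplacian A x := by
    rw [← integral_neg, ← MeasureTheory.integral_const_mul, ← integral_add j1.fun_neg j2]
    refine integral_congr_ae (Eventually.of_forall fun x => ?_)
    ring
  rw [e, integral_conv_mul_transport_eq_of_integrable hδ hv hvδ hε hε', neg_neg,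
    FunctionSpaces.Torus.integral_mul_laplacian_eq_neg_sum hA hA]
  -- `∑ⱼ ∫ (∂ⱼA)² = ∫ ‖∇A‖²`
  have hgrad : ∑ j, ∫ x, FunctionSpaces.Torus.partialDeriv j A x * FunctionSpaces.Torus.partialDeriv j A x = ∫ x, ‖FunctionSpaces.Torus.gradient A x‖ ^ 2 := by
    rw [← integral_finsetSum _ (f := fun j x => FunctionSpaces.Torus.partialDeriv j A x * FunctionSpaces.Torus.partialDeriv j A x) fun j _ =>
      ((hA.partialDeriv j).continuous.mul (hA.partialDeriv j).continuous).integrable_unitAddTorus]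
    refine integral_congr_ae (Eventually.of_forall fun x => ?_)
    dsimp only
    rw [EuclideanSpace.norm_sq_eq]
    refine Finset.sum_congr rfl fun j _ => ?_
    rw [FunctionSpaces.Torus.gradient_apply hA1, Real.norm_eq_abs, sq_abs, sq]
  rw [hgrad]
  ring

/-- **Weak incompressibility removes the smooth part of the transport pairing**, for an
integrable weakly divergence-free `v`, a measurable `δ` with `‖v‖ δ ∈ L¹`, and a smooth `B`:
`∫ δ ⟪v, ∇B⟫ = ∫ (δ - B) ⟪v, ∇B⟫` (`∫ B ⟪v, ∇B⟫ = ½ ∫ ⟪v, ∇(B²)⟫ = 0`). Generalises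
`integral_mul_inner_gradient_eq_integral_sub_mul` (a.e.-bounded `v`). [cite: BonicattoCiampaCrippa2023, Thm. 3.3 proof (3.1)–(3.2)] -/
theorem integral_mul_inner_gradient_eq_integral_sub_mul_of_integrable (hδm : AEStronglyMeasurable δ volume)
    (hv : Integrable v volume) (hvδ : Integrable (fun y => ‖v y‖ * δ y) volume)
    (hdiv : FunctionSpaces.Torus.IsWeaklyDivFree v)
    {B : UnitAddTorus d → ℝ} (hB : FunctionSpaces.Torus.IsSmooth B) :
    ∫ y, δ y * ⟪v y, FunctionSpaces.Torus.gradient B y⟫_ℝ = ∫ y, (δ - B) y * ⟪v y, FunctionSpaces.Torus.gradient B y⟫_ℝ := by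
  obtain ⟨Cg, hCg⟩ := FunctionSpaces.Torus.exists_forall_norm_le_of_continuous hB.gradient.continuous
  obtain ⟨CB, hCB⟩ := FunctionSpaces.Torus.exists_forall_norm_le_of_continuous hB.continuous
  have hm : AEStronglyMeasurable (fun y => ⟪v y, FunctionSpaces.Torus.gradient B y⟫_ℝ) volume :=
    hv.aestronglyMeasurable.inner hB.gradient.continuous.aestronglyMeasurable
  have i1 : Integrable (fun y => δ y * ⟪v y, FunctionSpaces.Torus.gradient B y⟫_ℝ) volume := by
    refine Integrable.mono' (hvδ.norm.const_mul Cg) (hδm.mul hm) (Eventually.of_forall fun y => ?_)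
    rw [norm_mul, Real.norm_eq_abs, Real.norm_eq_abs, norm_mul, norm_norm, Real.norm_eq_abs]
    calc |δ y| * |⟪v y, FunctionSpaces.Torus.gradient B y⟫_ℝ| ≤ |δ y| * (‖v y‖ * Cg) := by
          gcongr
          exact (abs_real_inner_le_norm _ _).trans (mul_le_mul_of_nonneg_left (hCg _) (norm_nonneg _))
      _ = Cg * (‖v y‖ * |δ y|) := by ring
  have i2 : Integrable (fun y => B y * ⟪v y, FunctionSpaces.Torus.gradient B y⟫_ℝ) volume := by
    refine Integrable.mono' (hv.norm.const_mul (CB * Cg)) (hB.continuous.aestronglyMeasurable.mul hm)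
      (Eventually.of_forall fun y => ?_)
    rw [norm_mul, Real.norm_eq_abs, Real.norm_eq_abs]
    have h1 : |B y| ≤ CB := by simpa [Real.norm_eq_abs] using hCB y
    have hCB0 : 0 ≤ CB := (abs_nonneg _).trans h1
    calc |B y| * |⟪v y, FunctionSpaces.Torus.gradient B y⟫_ℝ| ≤ CB * (‖v y‖ * Cg) := by
          gcongr
          exact (abs_real_inner_le_norm _ _).trans (mul_le_mul_of_nonneg_left (hCg _) (norm_nonneg _))
      _ = CB * Cg * ‖v y‖ := by ring
  simp_rw [Pi.sub_apply, sub_mul]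
  rw [integral_sub i1 i2, integral_mul_inner_gradient_eq_zero hB hdiv, sub_zero]

/-- **Pointwise-weighted Cauchy–Schwarz for the transport remainder**: for measurable `w`, `v` and a
smooth `B`, `‖∫ w ⟪v, ∇B⟫‖ₑ ≤ ‖w · ‖v‖‖_{L²} · ‖‖∇B‖‖_{L²}` (`|⟪v, ∇B⟫| ≤ ‖v‖ ‖∇B‖` pointwise,
then Hölder in `ℝ≥0∞`; no integrability is needed). [cite: Brezis2011, Thm. 4.6 (Hölder)] -/
theorem enorm_integral_mul_inner_gradient_le {w : UnitAddTorus d → ℝ} (hw : AEStronglyMeasurable w volume)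
    (hv : AEStronglyMeasurable v volume) {B : UnitAddTorus d → ℝ} (hB : FunctionSpaces.Torus.IsSmooth B) :
    ‖∫ y, w y * ⟪v y, FunctionSpaces.Torus.gradient B y⟫_ℝ‖ₑ ≤
      eLpNorm (fun y => w y * ‖v y‖) 2 volume *
        eLpNorm (fun y => ‖FunctionSpaces.Torus.gradient B y‖) 2 volume := by
  refine (enorm_integral_le_lintegral_enorm _).trans ?_
  have hpt : ∀ y, ‖w y * ⟪v y, FunctionSpaces.Torus.gradient B y⟫_ℝ‖ₑ ≤
      ‖w y * ‖v y‖‖ₑ * ‖‖FunctionSpaces.Torus.gradient B y‖‖ₑ := by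
    intro y
    rw [← enorm_mul, Real.enorm_eq_ofReal_abs, Real.enorm_eq_ofReal_abs]
    refine ENNReal.ofReal_le_ofReal ?_
    rw [abs_mul, abs_mul, abs_mul, abs_norm, abs_norm, mul_assoc]
    exact mul_le_mul_of_nonneg_left (abs_real_inner_le_norm _ _) (abs_nonneg _)
  refine (lintegral_mono hpt).trans ?_
  have hwm : AEStronglyMeasurable (fun y => w y * ‖v y‖) volume := hw.mul hv.norm
  have hgm : AEStronglyMeasurable (fun y => ‖FunctionSpaces.Torus.gradient B y‖) volume :=
    hB.gradient.continuous.norm.aestronglyMeasurable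
  have h := ENNReal.lintegral_mul_le_Lp_mul_Lq (volume : Measure (UnitAddTorus d))
    Real.HolderConjugate.two_two hwm.enorm hgm.enorm
  rw [eLpNorm_eq_lintegral_rpow_enorm_toReal two_ne_zero ENNReal.ofNat_ne_top,
    eLpNorm_eq_lintegral_rpow_enorm_toReal two_ne_zero ENNReal.ofNat_ne_top, ENNReal.toReal_ofNat]
  exact h

/-- **The slice energy estimate for BOUNDED slices and INTEGRABLE drifts** (the mollified energy
balance in Mescolini–Pitcho–Sorella 2025, proof of Thm. 2.4, and Bonicatto–Ciampa–Crippa 2024, proof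
of Thm. 3.3, (3.1), corner `p = 2`, `q = ∞`): for an a.e.-bounded integrable `δ`, an integrable
weakly divergence-free `v`, `k = kernel ε`, `A = δ ⋆ k`, `B = A ⋆ k`, and the flux
`G(x) = ∫ δ(y) (-⟪v y, ∇k(x-y)⟫ + κ Δk(x-y)) dy`,
`‖∫ A G + κ ∫ ‖∇A‖²‖ₑ ≤ ‖(δ - B)·‖v‖‖_{L²} · ‖∇A‖_{L²}` — TWO-SIDED, the remainder being the
weighted norm of `δ - B` (which is `≤ 2M` and tends to `0` in `L²`) against `‖v‖`.
[cite: MescoliniPitchoSorella2025, Thm. 2.4 proof pp. 1671–1674] -/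
theorem enorm_integral_conv_mul_flux_add_le (hδ : Integrable δ volume) {M : ℝ}
    (hδb : ∀ᵐ y ∂(volume : Measure (UnitAddTorus d)), |δ y| ≤ M) (hv : Integrable v volume)
    (hdiv : FunctionSpaces.Torus.IsWeaklyDivFree v) (hε : 0 < ε) (hε' : ε ≤ 1 / 4) (κ : ℝ) :
    ‖(∫ x, (δ ⋆ FunctionSpaces.Torus.kernel ε) x * ∫ y, δ y *
        (-⟪v y, FunctionSpaces.Torus.gradient (FunctionSpaces.Torus.kernel ε) (x - y)⟫_ℝ + κ * FunctionSpaces.Torus.laplacian (FunctionSpaces.Torus.kernel ε) (x - y))) +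
        κ * ∫ x, ‖FunctionSpaces.Torus.gradient (δ ⋆ FunctionSpaces.Torus.kernel ε) x‖ ^ 2‖ₑ ≤
      eLpNorm (fun y => (δ - (δ ⋆ FunctionSpaces.Torus.kernel ε) ⋆ FunctionSpaces.Torus.kernel ε) y * ‖v y‖) 2 volume *
        eLpNorm (fun x => ‖FunctionSpaces.Torus.gradient (δ ⋆ FunctionSpaces.Torus.kernel ε) x‖) 2 volume := by
  have hk : FunctionSpaces.Torus.IsSmooth (FunctionSpaces.Torus.kernel (d := d) ε) := FunctionSpaces.Torus.isSmooth_kernel hε hε'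
  have hA : FunctionSpaces.Torus.IsSmooth (δ ⋆ FunctionSpaces.Torus.kernel ε) := FunctionSpaces.Torus.isSmooth_convolution hδ hk
  have hB : FunctionSpaces.Torus.IsSmooth ((δ ⋆ FunctionSpaces.Torus.kernel ε) ⋆ FunctionSpaces.Torus.kernel ε) :=
    FunctionSpaces.Torus.isSmooth_convolution hA.integrable hk
  have hvδ : Integrable (fun y => ‖v y‖ * δ y) volume :=
    integrable_norm_mul_of_ae_abs_le hδ.aestronglyMeasurable hδb hv
  rw [integral_conv_mul_flux_eq_of_integrable hδ hv.aestronglyMeasurable hvδ hε hε' κ, sub_add_cancel,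
    integral_mul_inner_gradient_eq_integral_sub_mul_of_integrable hδ.aestronglyMeasurable hv hvδ hdiv hB]
  have hsm : AEStronglyMeasurable (δ - (δ ⋆ FunctionSpaces.Torus.kernel ε) ⋆ FunctionSpaces.Torus.kernel ε) volume :=
    hδ.aestronglyMeasurable.sub hB.continuous.aestronglyMeasurable
  refine (enorm_integral_mul_inner_gradient_le hsm hv.aestronglyMeasurable hB).trans ?_
  gcongr
  exact eLpNorm_norm_gradient_conv_kernel_le hA hε hε'

end Slice

/-! ## The spectral gradient norm of a mollified scalar -/

section Spectral

/-- **Mollification does not increase the spectral gradient norm of a real scalar**: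
`eScalarGradNormSq (f ⋆ kernel ε) ≤ eScalarGradNormSq f` for integrable `f` and `0 < ε ≤ 1/4`
(`𝓕(f ⋆ k_ε) = f̂ · k̂_ε` and `|k̂_ε| ≤ 1` termwise in `4π² ∑ |k|² |f̂(k)|²`; scalar twin of
`Torus.eGradNormSq_vecMollify_le`; the convolution theorem). [cite: Grafakos2014, Prop. 3.1.2 (9)] -/
theorem eScalarGradNormSq_convolution_kernel_le {f : UnitAddTorus d → ℝ} (hf : Integrable f volume)
    {ε : ℝ} (hε : 0 < ε) (hε' : ε ≤ 1 / 4) :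
    eScalarGradNormSq (f ⋆ FunctionSpaces.Torus.kernel ε) ≤ eScalarGradNormSq f := by
  rw [eScalarGradNormSq_eq_tsum, eScalarGradNormSq_eq_tsum]
  refine mul_le_mul' le_rfl (ENNReal.tsum_le_tsum fun k => mul_le_mul' le_rfl ?_)
  rw [FunctionSpaces.Torus.mFourierCoeff_ofReal_convolution_kernel hf
    (FunctionSpaces.Torus.continuous_kernel hε hε') k, enorm_mul, mul_pow]
  have h1 : ‖mFourierCoeff (fun x => (FunctionSpaces.Torus.kernel ε x : ℂ)) k‖ₑ ≤ 1 := by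
    rw [← ofReal_norm, ← ENNReal.ofReal_one]
    exact ENNReal.ofReal_le_ofReal (FunctionSpaces.Torus.norm_mFourierCoeff_ofReal_le_one
      (FunctionSpaces.Torus.continuous_kernel hε hε')
      (fun y => FunctionSpaces.Torus.kernel_nonneg hε.le y) (FunctionSpaces.Torus.integral_kernel hε hε') k)
  calc ‖mFourierCoeff (fun x => (f x : ℂ)) k‖ₑ ^ 2 * ‖mFourierCoeff (fun x => (FunctionSpaces.Torus.kernel ε x : ℂ)) k‖ₑ ^ 2
      ≤ ‖mFourierCoeff (fun x => (f x : ℂ)) k‖ₑ ^ 2 * 1 ^ 2 := by gcongr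
    _ = _ := by rw [one_pow, mul_one]

end Spectral

end Torus

end Literature.Analysis.FluidPDE
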